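import Literature.Combinatorics.Sahi2008.KahnIndependence
import Literature.Combinatorics.Sahi2008.KahnFixedPointExample
import Literature.Probability.LatticeModels.SahiThirdOrderCorrelation
import HarnessLib

/-!
# Kahn's `μ₃` — the fixed-point law of a uniform permutation of `[3]`: positively associated,
# NOT FUI, and a violation of Sahi's third-order inequality (4)

CITATION HEADER.  Source: J. Kahn, *A note on positive association*, arXiv:2210.08653 (2022)
[bib key `Kahn2022`], read 2026-08-19 from the materialised arXiv text (`lit read arxiv:2210.08653`,
corpus `paper:arxiv-2210.08653`, pp. 2–3), VERBATIM:

* p. 2: "Say `μ` is FUI (for finitely many underlying independents) in the first case [the `X_i`'s are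
  increasing functions of independent Bernoullis `Y_1,…,Y_m`], and UI in the second [a limit of such].
  … (2) are all PA measures FUI?  As we will see shortly, the answer is no".
  "**Theorem 2.** For any FUI `μ` and (increasing) `A,B,C`, (3) if `AB|C` and `AC|B` (and `μ(A) ≠ 0`),
  then `B|C`."
  "**Theorem 3.** [Doyle–Fishburn–Shepp] For a uniform permutation `σ` of `[n]`, the law, `μ_n`, of the
  set of fixed points of `σ` (that is, of `(X_1,…,X_n)`, where `X_i = 1_{σ(i)=i}`) is PA."
  "**Corollary 4.** The answer to (2) is negative.  *Proof.* This follows from Theorem 2 and the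
  observation that `μ = μ₃` violates (3): `μ` assigns weight `1/3` to `∅` and `1/6` to each of
  `{1},{2},{3},{1,2,3}` (and `0` to pairs); so, with `A_{i,j} = {σ fixes at least one of i,j}`,
  `A = A_{1,2}`, `B = A_{1,3}` and `C = A_{2,3}`, we have `μ(A) = μ(B) = μ(C) = 1/2`,
  `μ(AB) = ⋯ = 1/3`, and `μ(ABC) = 1/6`, whence the hypotheses of (3) hold but the conclusion does
  not. □"
* p. 3, on Sahi's Conjecture 5 = (4) `2μ(ABC) − [μ(AB)μ(C) + μ(AC)μ(B) + μ(BC)μ(A)] + μ(A)μ(B)μ(C) ≥ 0`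
  for product measures: "(4), with Harris, implies (3) (since under the hypotheses of (3), (4) becomes
  `μ(BC) ≤ μ(B)μ(C)`); so a positive answer to Question 1 [are all PA measures UI?], even just for
  `μ₃`, would say Sahi's Conjecture—which of course also implies (4) when `μ` is UI—is false."

Further sources: P. G. Doyle, P. C. Fishburn, L. A. Shepp, *The match set of a random permutation has
the FKG property*, Ann. Probab. **16** (1988) 1194–1214 [`DoyleFishburnShepp1988`] (positive
association of `μ_n` for every `n`; here only `n = 3` is reproduced, by a finite check);
N. Gladkov, *A strong FKG inequality for multiple events*, Bull. LMS **56** (2024), arXiv:2305.02653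
[`Gladkov2024StrongFKG`], Thm. 3.4 (= Kahn's Cor. 4: PA but not FUI) and **Thm. 3.5** ("There are
measures on `H_n` with positive associations which are not UI … Thus `μ₃` is not UI"), which closes
Kahn's Question 1 for `μ₃` and with it the route of p. 3 to a DISPROOF of Sahi's conjecture.  The UI
statement (limits of FUI laws) is NOT formalised here; the FUI statement is (`mu3_not_fui`).

DUPLICATE NOTICE (2026-08-19, recorded by the author seat).  The SAME printed material was formalised a
few minutes earlier by `Literature/Combinatorics/Sahi2008/KahnFixedPointExample.lean` (unit
`prim-gen-literature`, namespace `Literature.Combinatorics.Sahi2008.Kahn2022`: `mu3`, `mu3_real`, `pairEv`,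
`isPositivelyAssociated_mu3`, `mu3_violates_three`, `mu3_ne_map_prodBernoulli`, `kahn2022_cor4`,
`sahiE3_mu3`, `exists_isPositivelyAssociated_sahiE3_neg_kahn`).  THAT FILE IS CANONICAL — cite its
declarations.  This file is kept as a second, independent formalisation, now CROSS-IDENTIFIED with it
(`mu3_eq_kahn2022_mu3 : mu3 = Kahn2022.mu3`, `A_eq_pairEv`, `isPositivelyAssociated_mu3`, and the
canonical statements re-derived from this file's as `example`s), and for the two items it has in
addition: `mu3_real_eq_card` (the identification of Kahn's weights with the LAW OF THE FIXED-POINT SET of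
a uniform `σ ∈ S₃`, the six permutations enumerated in the kernel) and `kahnTransfer_map` / `mu3_not_fui`
for ARBITRARY coins `q ∈ [0,1]^κ` (degenerate coins allowed; the canonical `mu3_ne_map_prodBernoulli`
assumes `0 < q < 1`).

Origin: cell `prim-sahi` (bundle papers/CriticalPhenomena/sahi-implies-continuity/), unit
`prim-sahi-lit` gen 4; companion of `KahnPositiveAssociation.lean` (Kahn's Thm. 2, first proof) and
`Literature/Combinatorics/Sahi2008/KahnIndependence.lean` (Thm. 2, second proof, and its FUI form
`kahn2022_thm2_map`, used below).

WHAT IS PROVED (kernel; no named facts).  With `μ₃` DEFINED by Kahn's weights (`mu3`):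
* `mu3_real` (the weights), `mu3_real_eq_card` — `μ₃(𝒳) = #{σ ∈ S₃ : Fix(σ) ∈ 𝒳}/6`, i.e. `μ₃` IS the
  law of the fixed-point set of a uniform permutation of `[3]` (the six permutations enumerated by
  `decide`), `IsProbabilityMeasure mu3`;
* the events `A i j` and Kahn's seven values (`real_A01`, …, `real_A01_A02_A12`);
* `sahiE3_mu3 : sahiE3 μ₃ (A 0 1) (A 0 2) (A 1 2) = −1/24` — Sahi's (4) FAILS for `μ₃` (the tree's
  `sahiE3` is (4)'s left-hand side [LiebSahi2021, (2.1)]);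
* `mu3_posAssoc` — `μ₃` is positively associated (all pairs of increasing events), Doyle–Fishburn–Shepp
  at `n = 3`, by reduction to a `decide` over the ten membership bits of
  `∅, {0}, {1}, {2}, [3]` (pairs carry no mass);
* `KahnTransfer μ` — property (3); `kahnTransfer_map` — every FUI law `(P_q).map Φ` (`Φ` monotone,
  ANY coins `q ∈ [0,1]^κ`, frozen coins removed by `Kahn2022.prodBernoulli_real_eq_liftCfg`) has it
  (Theorem 2, via `kahn2022_thm2_map`); `mu3_not_kahnTransfer`; hence **`mu3_not_fui`**: no monotone
  image of a finite product measure equals `μ₃` (Corollary 4).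
So positive association does NOT imply Sahi's `C₃`: the hypothesis class of
`Summit.…Theorems.SahiConjecture` (FKG measures ⊆ FUI, `IsFKGMeasure.exists_coinRepresentation`)
cannot be widened to PA measures. [cite: Kahn2022, p. 3]
-/

noncomputable section

open MeasureTheory Finset
open scoped NNReal ENNReal

namespace Literature.Probability.LatticeModels.MatchSet

/-! ### Kahn's `μ₃` -/

/-- **Kahn's `μ₃`** on `2^{[3]}` (here `Set (Fin 3)`, points `0,1,2`): "`μ` assigns weight `1/3` to `∅`
and `1/6` to each of `{1},{2},{3},{1,2,3}` (and `0` to pairs)" — the law of the fixed-point set of a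
uniform permutation of `[3]` (`mu3_real_eq_card`). [cite: Kahn2022, proof of Cor. 4 (arXiv p. 2)] -/
def mu3 : Measure (Set (Fin 3)) :=
  ((3 : ℝ≥0)⁻¹) • Measure.dirac (∅ : Set (Fin 3)) +
    ((6 : ℝ≥0)⁻¹) • (Measure.dirac ({0} : Set (Fin 3)) + Measure.dirac ({1} : Set (Fin 3)) +
      Measure.dirac ({2} : Set (Fin 3)) + Measure.dirac (Set.univ : Set (Fin 3)))

/-- Boolean membership bit of a point in an event (classical; plumbing). [folklore] -/
def bmem (𝒳 : Set (Set (Fin 3))) (S : Set (Fin 3)) : Bool := by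
  classical exact decide (S ∈ 𝒳)

/-- The real indicator `1_{S ∈ 𝒳}` (plumbing). [folklore] -/
def chi (𝒳 : Set (Set (Fin 3))) (S : Set (Fin 3)) : ℝ := ((bmem 𝒳 S).toNat : ℝ)

/-- Indicator of a member. [folklore] -/
private theorem chi_of_mem {𝒳 : Set (Set (Fin 3))} {S : Set (Fin 3)} (h : S ∈ 𝒳) : chi 𝒳 S = 1 := by
  classical
  simp [chi, bmem, h]

/-- Indicator of a non-member. [folklore] -/
private theorem chi_of_not_mem {𝒳 : Set (Set (Fin 3))} {S : Set (Fin 3)} (h : S ∉ 𝒳) : chi 𝒳 S = 0 := by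
  classical
  simp [chi, bmem, h]

/-- A Dirac mass charges an event by its indicator. [folklore] -/
private theorem real_dirac (S : Set (Fin 3)) (𝒳 : Set (Set (Fin 3))) :
    (Measure.dirac S).real 𝒳 = chi 𝒳 S := by
  classical
  rw [measureReal_def, Measure.dirac_apply' _ MeasurableSet.of_discrete, Set.indicator_apply]
  by_cases h : S ∈ 𝒳
  · rw [if_pos h, chi_of_mem h]; simp
  · rw [if_neg h, chi_of_not_mem h]; simp

/-- **The weights of `μ₃`**: `μ₃(𝒳) = (1/3)·1_{∅∈𝒳} + (1/6)(1_{{0}∈𝒳} + 1_{{1}∈𝒳} + 1_{{2}∈𝒳} + 1_{[3]∈𝒳})`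
(pairs carry no mass). [cite: Kahn2022, proof of Cor. 4 (arXiv p. 2)] -/
theorem mu3_real (𝒳 : Set (Set (Fin 3))) :
    mu3.real 𝒳 = (1 / 3) * chi 𝒳 ∅ +
      (1 / 6) * (chi 𝒳 {0} + chi 𝒳 {1} + chi 𝒳 {2} + chi 𝒳 Set.univ) := by
  have e1 : mu3.real 𝒳 = (((3 : ℝ≥0)⁻¹) • Measure.dirac (∅ : Set (Fin 3))).real 𝒳 +
      (((6 : ℝ≥0)⁻¹) • (Measure.dirac ({0} : Set (Fin 3)) + Measure.dirac ({1} : Set (Fin 3)) +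
        Measure.dirac ({2} : Set (Fin 3)) + Measure.dirac (Set.univ : Set (Fin 3)))).real 𝒳 :=
    measureReal_add_apply (measure_ne_top _ _) (measure_ne_top _ _)
  rw [e1, measureReal_nnreal_smul_apply, measureReal_nnreal_smul_apply,
    measureReal_add_apply (measure_ne_top _ _) (measure_ne_top _ _),
    measureReal_add_apply (measure_ne_top _ _) (measure_ne_top _ _),
    measureReal_add_apply (measure_ne_top _ _) (measure_ne_top _ _)]
  simp only [real_dirac]
  push_cast
  ring

/-- `μ₃` has total mass `1`. [cite: Kahn2022, proof of Cor. 4 (arXiv p. 2)] -/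
theorem mu3_real_univ : mu3.real Set.univ = 1 := by
  rw [mu3_real, chi_of_mem (Set.mem_univ _), chi_of_mem (Set.mem_univ _), chi_of_mem (Set.mem_univ _),
    chi_of_mem (Set.mem_univ _), chi_of_mem (Set.mem_univ _)]
  norm_num

/-- `μ₃` is a probability measure. [cite: Kahn2022, proof of Cor. 4 (arXiv p. 2)] -/
instance : IsProbabilityMeasure mu3 := by
  constructor
  have h := mu3_real_univ
  rw [measureReal_def, ENNReal.toReal_eq_one_iff] at h
  exact h

/-! ### `μ₃` is the law of the fixed-point set of a uniform permutation of `[3]` -/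

/-- The fixed-point (match) set `{i | σ(i) = i}` of a permutation of `[3]`, as a finset (`X_i = 1_{σ(i)=i}`).
[cite: Kahn2022, Thm. 3 (arXiv p. 2)] -/
def fixF (σ : Equiv.Perm (Fin 3)) : Finset (Fin 3) := univ.filter fun i => σ i = i

/-- The fixed-point sets occurring in `S₃`: `∅` (3-cycles), singletons (transpositions), `[3]` (identity). [folklore] -/
private theorem image_fixF :
    univ.image fixF = ({∅, {0}, {1}, {2}, univ} : Finset (Finset (Fin 3))) := by decide
/-- Two derangements. [folklore] -/
private theorem card_fixF_empty : (univ.filter fun σ : Equiv.Perm (Fin 3) => fixF σ = ∅).card = 2 := by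
  decide
/-- One transposition fixes exactly `0`. [folklore] -/
private theorem card_fixF_zero : (univ.filter fun σ : Equiv.Perm (Fin 3) => fixF σ = {0}).card = 1 := by
  decide
/-- One transposition fixes exactly `1`. [folklore] -/
private theorem card_fixF_one : (univ.filter fun σ : Equiv.Perm (Fin 3) => fixF σ = {1}).card = 1 := by
  decide
/-- One transposition fixes exactly `2`. [folklore] -/
private theorem card_fixF_two : (univ.filter fun σ : Equiv.Perm (Fin 3) => fixF σ = {2}).card = 1 := by
  decide
/-- Only the identity fixes everything. [folklore] -/
private theorem card_fixF_univ : (univ.filter fun σ : Equiv.Perm (Fin 3) => fixF σ = univ).card = 1 := by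
  decide

/-- **`μ₃` is the law of the set of fixed points of a uniform permutation of `[3]`**: for every event
`𝒳`, `μ₃(𝒳) = #{σ ∈ S₃ : Fix(σ) ∈ 𝒳} / 6` (regroup the six permutations along their fixed-point sets:
two derangements, three transpositions, the identity). [cite: Kahn2022, Thm. 3 and proof of Cor. 4 (arXiv p. 2)] -/
theorem mu3_real_eq_card (𝒳 : Set (Set (Fin 3))) :
    mu3.real 𝒳 =
      ((univ.filter fun σ : Equiv.Perm (Fin 3) => bmem 𝒳 (fixF σ : Set (Fin 3))).card : ℝ) / 6 := by
  classical
  -- count = Σ_σ χ(Fix σ) regrouped along the image of `fixF`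
  have hcount : ((univ.filter fun σ : Equiv.Perm (Fin 3) => bmem 𝒳 (fixF σ : Set (Fin 3))).card : ℝ)
      = ∑ T ∈ univ.image fixF,
          ((univ.filter fun σ : Equiv.Perm (Fin 3) => fixF σ = T).card : ℝ) * chi 𝒳 (T : Set (Fin 3)) := by
    have h1 : ((univ.filter fun σ : Equiv.Perm (Fin 3) => bmem 𝒳 (fixF σ : Set (Fin 3))).card : ℝ)
        = ∑ σ : Equiv.Perm (Fin 3), chi 𝒳 (fixF σ : Set (Fin 3)) := by
      rw [Finset.card_filter]
      push_cast
      refine Finset.sum_congr rfl fun σ _ => ?_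
      unfold chi
      cases bmem 𝒳 (fixF σ : Set (Fin 3)) <;> simp
    rw [h1, Finset.sum_comp (fun T : Finset (Fin 3) => chi 𝒳 (T : Set (Fin 3))) fixF]
    refine Finset.sum_congr rfl fun T _ => ?_
    rw [nsmul_eq_mul]
  rw [hcount, image_fixF]
  rw [Finset.sum_insert (by decide), Finset.sum_insert (by decide), Finset.sum_insert (by decide),
    Finset.sum_insert (by decide), Finset.sum_singleton, card_fixF_empty, card_fixF_zero, card_fixF_one,
    card_fixF_two, card_fixF_univ, mu3_real]
  push_cast
  ring


/-! ### Kahn's events `A_{i,j}` and the values of `μ₃` -/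

/-- Kahn's increasing events `A_{i,j} = {σ fixes at least one of i, j}`, as events on the fixed-point set:
`{S | i ∈ S ∨ j ∈ S}`. [cite: Kahn2022, proof of Cor. 4 (arXiv p. 2)] -/
def A (i j : Fin 3) : Set (Set (Fin 3)) := {S | i ∈ S ∨ j ∈ S}

/-- `A_{i,j}` is increasing. [cite: Kahn2022, proof of Cor. 4 (arXiv p. 2)] -/
theorem isUpperSet_A (i j : Fin 3) : IsUpperSet (A i j) := by
  intro S T hST h
  rcases h with h | h
  · exact Or.inl (hST h)
  · exact Or.inr (hST h)

/-- Evaluation of `μ₃` from the five membership bits (plumbing). [folklore] -/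
private theorem mu3_real_eval (𝒳 : Set (Set (Fin 3))) (c0 c1 c2 c3 c4 : ℝ)
    (h0 : chi 𝒳 ∅ = c0) (h1 : chi 𝒳 {0} = c1) (h2 : chi 𝒳 {1} = c2) (h3 : chi 𝒳 {2} = c3)
    (h4 : chi 𝒳 Set.univ = c4) :
    mu3.real 𝒳 = (1 / 3) * c0 + (1 / 6) * (c1 + c2 + c3 + c4) := by
  rw [mu3_real, h0, h1, h2, h3, h4]

/-- `μ₃(A_{1,2}) = 1/2` (points `0,1`). [cite: Kahn2022, proof of Cor. 4 (arXiv p. 2)] -/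
theorem real_A01 : mu3.real (A 0 1) = 1 / 2 := by
  rw [mu3_real_eval (A 0 1) 0 1 1 0 1]
  · norm_num
  all_goals first
    | (apply chi_of_mem; simp [A])
    | (apply chi_of_not_mem; simp [A])

/-- `μ₃(A_{1,3}) = 1/2`. [cite: Kahn2022, proof of Cor. 4 (arXiv p. 2)] -/
theorem real_A02 : mu3.real (A 0 2) = 1 / 2 := by
  rw [mu3_real_eval (A 0 2) 0 1 0 1 1]
  · norm_num
  all_goals first
    | (apply chi_of_mem; simp [A])
    | (apply chi_of_not_mem; simp [A])

/-- `μ₃(A_{2,3}) = 1/2`. [cite: Kahn2022, proof of Cor. 4 (arXiv p. 2)] -/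
theorem real_A12 : mu3.real (A 1 2) = 1 / 2 := by
  rw [mu3_real_eval (A 1 2) 0 0 1 1 1]
  · norm_num
  all_goals first
    | (apply chi_of_mem; simp [A])
    | (apply chi_of_not_mem; simp [A])

/-- `μ₃(AB) = 1/3`. [cite: Kahn2022, proof of Cor. 4 (arXiv p. 2)] -/
theorem real_A01_A02 : mu3.real (A 0 1 ∩ A 0 2) = 1 / 3 := by
  rw [mu3_real_eval (A 0 1 ∩ A 0 2) 0 1 0 0 1]
  · norm_num
  all_goals first
    | (apply chi_of_mem; simp [A])
    | (apply chi_of_not_mem; simp [A])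

/-- `μ₃(AC) = 1/3`. [cite: Kahn2022, proof of Cor. 4 (arXiv p. 2)] -/
theorem real_A01_A12 : mu3.real (A 0 1 ∩ A 1 2) = 1 / 3 := by
  rw [mu3_real_eval (A 0 1 ∩ A 1 2) 0 0 1 0 1]
  · norm_num
  all_goals first
    | (apply chi_of_mem; simp [A])
    | (apply chi_of_not_mem; simp [A])

/-- `μ₃(BC) = 1/3`. [cite: Kahn2022, proof of Cor. 4 (arXiv p. 2)] -/
theorem real_A02_A12 : mu3.real (A 0 2 ∩ A 1 2) = 1 / 3 := by
  rw [mu3_real_eval (A 0 2 ∩ A 1 2) 0 0 0 1 1]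
  · norm_num
  all_goals first
    | (apply chi_of_mem; simp [A])
    | (apply chi_of_not_mem; simp [A])

/-- `μ₃(ABC) = 1/6`. [cite: Kahn2022, proof of Cor. 4 (arXiv p. 2)] -/
theorem real_A01_A02_A12 : mu3.real (A 0 1 ∩ A 0 2 ∩ A 1 2) = 1 / 6 := by
  rw [mu3_real_eval (A 0 1 ∩ A 0 2 ∩ A 1 2) 0 0 0 0 1]
  · norm_num
  all_goals first
    | (apply chi_of_mem; simp [A])
    | (apply chi_of_not_mem; simp [A])

/-- `μ₃(ACB) = 1/6` (the bracketing used by hypothesis `AC|B`). [cite: Kahn2022, proof of Cor. 4 (arXiv p. 2)] -/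
theorem real_A01_A12_A02 : mu3.real (A 0 1 ∩ A 1 2 ∩ A 0 2) = 1 / 6 := by
  rw [mu3_real_eval (A 0 1 ∩ A 1 2 ∩ A 0 2) 0 0 0 0 1]
  · norm_num
  all_goals first
    | (apply chi_of_mem; simp [A])
    | (apply chi_of_not_mem; simp [A])

/-! ### Sahi's inequality (4) fails for `μ₃` -/

/-- **Sahi's third-order inequality (4) FAILS for the PA law `μ₃`**: with `A = A_{1,2}`, `B = A_{1,3}`,
`C = A_{2,3}`, `E₃ = 2μ(ABC) − [μ(AB)μ(C) + μ(AC)μ(B) + μ(BC)μ(A)] + μ(A)μ(B)μ(C) = 2·(1/6) − 3·(1/3)(1/2) + 1/8 = −1/24`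
("(4), with Harris, implies (3)"; `μ₃` satisfies the hypotheses of (3) and violates its conclusion, so it
violates (4)).  Hence positive association alone does not imply Sahi's `C₃`. [cite: Kahn2022, p. 3 and proof of Cor. 4 (arXiv p. 2)] -/
theorem sahiE3_mu3 : sahiE3 mu3 (A 0 1) (A 0 2) (A 1 2) = -1 / 24 := by
  rw [sahiE3, real_A01_A02_A12, real_A01, real_A02, real_A12, real_A02_A12, real_A01_A12, real_A01_A02]
  norm_num

/-! ### `μ₃` is positively associated (Doyle–Fishburn–Shepp, `n = 3`) -/

/-- The finite core of positive association for `μ₃`: over the ten membership bits of `∅,{0},{1},{2},[3]`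
in two up-sets (bits increasing along `∅ ⊆ {i} ⊆ [3]`), `36·μ₃(𝒜)μ₃(ℬ) ≤ 36·μ₃(𝒜 ∩ ℬ)`. [folklore] -/
private theorem pa_core : ∀ (a0 a1 a2 a3 a4 b0 b1 b2 b3 b4 : Bool),
    a0 ≤ a1 → a0 ≤ a2 → a0 ≤ a3 → a1 ≤ a4 → a2 ≤ a4 → a3 ≤ a4 →
    b0 ≤ b1 → b0 ≤ b2 → b0 ≤ b3 → b1 ≤ b4 → b2 ≤ b4 → b3 ≤ b4 →
    (2 * a0.toNat + a1.toNat + a2.toNat + a3.toNat + a4.toNat) *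
        (2 * b0.toNat + b1.toNat + b2.toNat + b3.toNat + b4.toNat) ≤
      6 * (2 * (a0 && b0).toNat + (a1 && b1).toNat + (a2 && b2).toNat + (a3 && b3).toNat +
        (a4 && b4).toNat) := by
  decide

/-- Membership bits of an up-set increase along `⊆`. [folklore] -/
private theorem bmem_le {𝒳 : Set (Set (Fin 3))} (h𝒳 : IsUpperSet 𝒳) {S T : Set (Fin 3)} (hST : S ⊆ T) :
    bmem 𝒳 S ≤ bmem 𝒳 T := by
  classical
  unfold bmem
  by_cases hS : S ∈ 𝒳
  · have hT : T ∈ 𝒳 := h𝒳 hST hS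
    simp [hS, hT]
  · simp [hS]

/-- Indicator of an intersection. [folklore] -/
private theorem chi_inter (𝒳 𝒴 : Set (Set (Fin 3))) (S : Set (Fin 3)) :
    chi (𝒳 ∩ 𝒴) S = ((bmem 𝒳 S && bmem 𝒴 S).toNat : ℝ) := by
  classical
  unfold chi bmem
  by_cases h1 : S ∈ 𝒳 <;> by_cases h2 : S ∈ 𝒴 <;> simp [h1, h2]

/-- **`μ₃` is positively associated** (Doyle–Fishburn–Shepp, the case `n = 3`): any two increasing events
are positively correlated, `μ₃(𝒜)μ₃(ℬ) ≤ μ₃(𝒜 ∩ ℬ)`.  Proof here: a finite check (`pa_core`) over the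
membership bits of the five charged points. [cite: Kahn2022, Thm. 3 (arXiv p. 2)]
[cite: DoyleFishburnShepp1988, main theorem (the case n = 3, as quoted in Kahn2022 Thm. 3)] -/
theorem mu3_posAssoc {𝒜 ℬ : Set (Set (Fin 3))} (h𝒜 : IsUpperSet 𝒜) (hℬ : IsUpperSet ℬ) :
    mu3.real 𝒜 * mu3.real ℬ ≤ mu3.real (𝒜 ∩ ℬ) := by
  have e0 : (∅ : Set (Fin 3)) ⊆ {0} := Set.empty_subset _
  have e1 : (∅ : Set (Fin 3)) ⊆ {1} := Set.empty_subset _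
  have e2 : (∅ : Set (Fin 3)) ⊆ {2} := Set.empty_subset _
  have u0 : ({0} : Set (Fin 3)) ⊆ Set.univ := Set.subset_univ _
  have u1 : ({1} : Set (Fin 3)) ⊆ Set.univ := Set.subset_univ _
  have u2 : ({2} : Set (Fin 3)) ⊆ Set.univ := Set.subset_univ _
  have H := pa_core (bmem 𝒜 ∅) (bmem 𝒜 {0}) (bmem 𝒜 {1}) (bmem 𝒜 {2}) (bmem 𝒜 Set.univ)
    (bmem ℬ ∅) (bmem ℬ {0}) (bmem ℬ {1}) (bmem ℬ {2}) (bmem ℬ Set.univ)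
    (bmem_le h𝒜 e0) (bmem_le h𝒜 e1) (bmem_le h𝒜 e2) (bmem_le h𝒜 u0) (bmem_le h𝒜 u1) (bmem_le h𝒜 u2)
    (bmem_le hℬ e0) (bmem_le hℬ e1) (bmem_le hℬ e2) (bmem_le hℬ u0) (bmem_le hℬ u1) (bmem_le hℬ u2)
  have H' : ((2 * (bmem 𝒜 ∅).toNat + (bmem 𝒜 {0}).toNat + (bmem 𝒜 {1}).toNat + (bmem 𝒜 {2}).toNat +
      (bmem 𝒜 Set.univ).toNat : ℕ) : ℝ) * ((2 * (bmem ℬ ∅).toNat + (bmem ℬ {0}).toNat +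
      (bmem ℬ {1}).toNat + (bmem ℬ {2}).toNat + (bmem ℬ Set.univ).toNat : ℕ) : ℝ) ≤
      6 * ((2 * (bmem 𝒜 ∅ && bmem ℬ ∅).toNat + (bmem 𝒜 {0} && bmem ℬ {0}).toNat +
        (bmem 𝒜 {1} && bmem ℬ {1}).toNat + (bmem 𝒜 {2} && bmem ℬ {2}).toNat +
        (bmem 𝒜 Set.univ && bmem ℬ Set.univ).toNat : ℕ) : ℝ) := by
    exact_mod_cast H
  rw [mu3_real 𝒜, mu3_real ℬ, mu3_real (𝒜 ∩ ℬ), chi_inter, chi_inter, chi_inter, chi_inter, chi_inter]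
  unfold chi
  push_cast at H' ⊢
  nlinarith [H']

/-! ### Kahn's Theorem 2 property, FUI laws, and `μ₃` -/

variable {ι : Type*}

/-- Kahn's property (3) of a law `μ` on `2^ι`: for all increasing `A, B, C` with `μ(A) ≠ 0`,
`AB|C` and `AC|B` imply `B|C` (`X|Y` = independence `μ(XY) = μ(X)μ(Y)`). [cite: Kahn2022, Thm. 2, display (3) (arXiv p. 2)] -/
def KahnTransfer (μ : Measure (Set ι)) : Prop :=
  ∀ 𝒜 ℬ 𝒞 : Set (Set ι), IsUpperSet 𝒜 → IsUpperSet ℬ → IsUpperSet 𝒞 → μ.real 𝒜 ≠ 0 →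
    μ.real (𝒜 ∩ ℬ ∩ 𝒞) = μ.real (𝒜 ∩ ℬ) * μ.real 𝒞 →
    μ.real (𝒜 ∩ 𝒞 ∩ ℬ) = μ.real (𝒜 ∩ 𝒞) * μ.real ℬ →
    μ.real (ℬ ∩ 𝒞) = μ.real ℬ * μ.real 𝒞

/-- **Kahn 2022, Theorem 2: every FUI law has property (3)** — `μ = (P_q).map Φ` for a monotone
`Φ : 2^κ → 2^ι` and ANY coins `q ∈ [0,1]^κ` (frozen coins are removed by the monotone lift of
`Kahn2022.prodBernoulli_real_eq_liftCfg`, then `kahn2022_thm2_map`). [cite: Kahn2022, Thm. 2 and "Underlying independents" (arXiv p. 2)] -/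
theorem kahnTransfer_map [Fintype ι] {κ : Type*} [Fintype κ] (q : κ → unitInterval)
    {Φ : Set κ → Set ι} (hΦ : Monotone Φ) : KahnTransfer ((prodBernoulli q).map Φ) := by
  classical
  intro 𝒜 ℬ 𝒞 h𝒜 hℬ h𝒞 h0 hABC hACB
  -- remove the frozen coins: `μ = (P_{q°}).map (Φ ∘ lift)` on every event
  have key : ∀ S : Set (Set ι), ((prodBernoulli q).map Φ).real S =
      ((prodBernoulli fun k : Literature.Combinatorics.Sahi2008.Kahn2022.NonDeg q => q k).map
        (Φ ∘ Literature.Combinatorics.Sahi2008.Kahn2022.liftCfg q)).real S := by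
    intro S
    rw [measureReal_def, measureReal_def,
      Measure.map_apply (Measurable.of_discrete) MeasurableSet.of_discrete,
      Measure.map_apply (Measurable.of_discrete) MeasurableSet.of_discrete,
      ← measureReal_def, ← measureReal_def, Set.preimage_comp,
      Literature.Combinatorics.Sahi2008.Kahn2022.prodBernoulli_real_eq_liftCfg]
  simp only [key] at h0 hABC hACB ⊢
  have hq : ∀ k : Literature.Combinatorics.Sahi2008.Kahn2022.NonDeg q,
      0 < (fun k : Literature.Combinatorics.Sahi2008.Kahn2022.NonDeg q => q k) k ∧
      (fun k : Literature.Combinatorics.Sahi2008.Kahn2022.NonDeg q => q k) k < 1 := fun k => k.2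
  exact Literature.Combinatorics.Sahi2008.kahn2022_thm2_map hq
    (hΦ.comp (Literature.Combinatorics.Sahi2008.Kahn2022.liftCfg_mono q)) h𝒜 hℬ h𝒞 h0 hABC hACB

/-- **`μ₃` violates (3)**: with `A = A_{1,2}`, `B = A_{1,3}`, `C = A_{2,3}` the hypotheses hold
(`1/6 = (1/3)(1/2)` twice, `μ(A) = 1/2 ≠ 0`) but `μ(BC) = 1/3 ≠ 1/4 = μ(B)μ(C)`. [cite: Kahn2022, proof of Cor. 4 (arXiv p. 2)] -/
theorem mu3_not_kahnTransfer : ¬ KahnTransfer mu3 := by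
  intro h
  have h1 := h (A 0 1) (A 0 2) (A 1 2) (isUpperSet_A 0 1) (isUpperSet_A 0 2) (isUpperSet_A 1 2)
    (by rw [real_A01]; norm_num)
    (by rw [real_A01_A02_A12, real_A01_A02, real_A12]; norm_num)
    (by rw [real_A01_A12_A02, real_A01_A12, real_A02]; norm_num)
  rw [real_A02_A12, real_A02, real_A12] at h1
  norm_num at h1

/-- **Kahn 2022, Corollary 4 ("the answer to (2) is negative"): `μ₃` is PA but NOT FUI** — no monotone
image of a finite product measure (any coins, any finite index type) is `μ₃`.  Gladkov 2024 Thm. 3.5 extends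
this to UI (limits of FUI laws; not formalised here). [cite: Kahn2022, Cor. 4 (arXiv p. 2)]
[cite: Gladkov2024StrongFKG, Thm. 3.4 and Thm. 3.5] -/
theorem mu3_not_fui {κ : Type*} [Fintype κ] (q : κ → unitInterval) {Φ : Set κ → Set (Fin 3)}
    (hΦ : Monotone Φ) : (prodBernoulli q).map Φ ≠ mu3 := by
  intro h
  have hK := kahnTransfer_map q hΦ
  rw [h] at hK
  exact mu3_not_kahnTransfer hK


/-! ### Cross-identification with the canonical file `Sahi2008/KahnFixedPointExample.lean` -/

/-- The events coincide: this file's `A i j` is the canonical `Kahn2022.pairEv i j`.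
[cite: Kahn2022, proof of Cor. 4 (arXiv p. 2)] -/
theorem A_eq_pairEv (i j : Fin 3) : A i j = Literature.Combinatorics.Sahi2008.Kahn2022.pairEv i j := rfl

/-- The two formalisations of `μ₃` agree on every event. [cite: Kahn2022, proof of Cor. 4 (arXiv p. 2)] -/
theorem mu3_real_eq_kahn2022 (𝒳 : Set (Set (Fin 3))) :
    mu3.real 𝒳 = (Literature.Combinatorics.Sahi2008.Kahn2022.mu3).real 𝒳 := by
  classical
  rw [mu3_real, Literature.Combinatorics.Sahi2008.Kahn2022.mu3_real,
    Literature.Combinatorics.Sahi2008.Kahn2022.w3]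
  unfold chi bmem
  by_cases h0 : (∅ : Set (Fin 3)) ∈ 𝒳 <;> by_cases h1 : ({0} : Set (Fin 3)) ∈ 𝒳 <;>
    by_cases h2 : ({1} : Set (Fin 3)) ∈ 𝒳 <;> by_cases h3 : ({2} : Set (Fin 3)) ∈ 𝒳 <;>
      by_cases h4 : (Set.univ : Set (Fin 3)) ∈ 𝒳 <;> simp [h0, h1, h2, h3, h4] <;> norm_num

/-- **One object, two files**: this file's `μ₃` IS the canonical `Kahn2022.mu3` (equal as measures).
[cite: Kahn2022, proof of Cor. 4 (arXiv p. 2)] -/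
theorem mu3_eq_kahn2022_mu3 : mu3 = Literature.Combinatorics.Sahi2008.Kahn2022.mu3 := by
  refine Measure.ext fun 𝒳 _ => ?_
  have h := mu3_real_eq_kahn2022 𝒳
  rw [measureReal_def, measureReal_def] at h
  exact (ENNReal.toReal_eq_toReal_iff' (measure_ne_top _ _) (measure_ne_top _ _)).mp h

/-- Positive association in the tree's predicate `IsPositivelyAssociated`, from `mu3_posAssoc`
(equivalently: the canonical `Kahn2022.isPositivelyAssociated_mu3` transported along `mu3_eq_kahn2022_mu3`).
[cite: Kahn2022, Thm. 3 (arXiv p. 2)] -/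
theorem isPositivelyAssociated_mu3 : Literature.Probability.Percolation.IsPositivelyAssociated mu3 :=
  Literature.Probability.Percolation.isPositivelyAssociated_of_real fun _ _ h𝒜 hℬ _ _ => mu3_posAssoc h𝒜 hℬ

/-- The canonical positive-association theorem, re-derived from this file's finite check. -/
example : Literature.Probability.Percolation.IsPositivelyAssociated
    Literature.Combinatorics.Sahi2008.Kahn2022.mu3 :=
  mu3_eq_kahn2022_mu3 ▸ isPositivelyAssociated_mu3

/-- The canonical `E₃ = −1/24`, re-derived from this file's `sahiE3_mu3`. -/
example : sahiE3 Literature.Combinatorics.Sahi2008.Kahn2022.mu3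
    (Literature.Combinatorics.Sahi2008.Kahn2022.pairEv 0 1)
    (Literature.Combinatorics.Sahi2008.Kahn2022.pairEv 0 2)
    (Literature.Combinatorics.Sahi2008.Kahn2022.pairEv 1 2) = -1 / 24 := by
  rw [← mu3_eq_kahn2022_mu3, ← A_eq_pairEv, ← A_eq_pairEv, ← A_eq_pairEv, sahiE3_mu3]

/-- The canonical non-FUI statement (non-degenerate coins) is the special case of this file's
`mu3_not_fui` (any coins). -/
example {κ : Type*} [Fintype κ] {q : κ → unitInterval} (_hq : ∀ k, 0 < q k ∧ q k < 1)
    {Φ : Set κ → Set (Fin 3)} (hΦ : Monotone Φ) :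
    (prodBernoulli q).map Φ ≠ Literature.Combinatorics.Sahi2008.Kahn2022.mu3 := by
  rw [← mu3_eq_kahn2022_mu3]; exact mu3_not_fui q hΦ

end Literature.Probability.LatticeModels.MatchSet

end
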